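import Literature.AlgebraicGeometry.Motives.Comparison
import HarnessLib

/-!
# The period field is generated by a period matrix
(discharge of `Literature.AlgebraicGeometry.Motives.periodField_eq_closure_range_periodMatrix`)

Huber–Müller-Stach, *Periods and Nori Motives* (2017), Ch. 11 §11.2 "Periods for the category
`(k, ℚ)−Vect`" (= §9.2 of the 2015 preprint, whose numbering is given in brackets):

* Definition 11.2.1 [9.2.1]: for `V = (V_k, V_ℚ, φ_ℂ)` the *period matrix* of `V` is the matrix
  of `φ_ℂ` in a choice of bases `v₁, …, vₙ` of `V_k` and `w₁, …, wₙ` of `V_ℚ`; a complex number is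
  a *period* of `V` if it is an entry of a period matrix of `V` for some choice of bases; `ℙ⟨V⟩`
  is the `k`-subvector space of `ℂ` generated by the entries of the period matrix.
* Remark 11.2.2 (1) [9.2.2]: `V` gives a bilinear pairing `V_k × V_ℚ^∨ → ℂ`,
  `(v, λ) ↦ λ(φ_ℂ⁻¹(v))`, with `λ` extended `ℂ`-linearly; "the periods of `V` are the numbers in
  its image" and "the period matrix depends on the choice of bases, but the vector space `ℙ⟨V⟩`
  does not".
* Lemma 11.2.3 (1) [9.2.3]: the set of periods is closed under multiplication by `k`
  ("multiplying a basis element `wᵢ` by an element `α` in `k` multiplies the periods by `α`").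

In `Motives/Comparison` the pairing picture is `periodSet ι` (for a general `L`-linear
`ι : L ⊗_{K₁} V₁ → L ⊗_{K₂} V₂`, periods `φ_L(ι(1 ⊗ v))`), the period matrix is
`periodMatrix ι b₁ b₂`, and `periodField ι` is the subfield of `L` the periods generate. The
named fact `periodField_eq_closure_range_periodMatrix` — for `ι` injective, `V₁ ≠ 0` and finite
bases `b₁`, `b₂`, the period field is the subfield generated by (the images of) `K₁`, `K₂` and
the entries of the period matrix — is proved here (`periodField_eq_closure_range_periodMatrix_holds`)
by making the two remarks of the book explicit:

* `⊆`: writing `v = Σⱼ cⱼ b₁ j` (`cⱼ ∈ K₁`) and expanding in the base-changed basis `1 ⊗ b₂`,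
  every period is `φ_L(ι(1 ⊗ v)) = Σⱼ Σᵢ cⱼ · Pᵢⱼ · φ(b₂ i)` with `P` the period matrix
  (`dual_baseChange_map_one_tmul_eq_sum`), a `K₁`-`K₂`-bilinear combination of its entries;
* `⊇`: the entries are periods (`periodMatrix_mem_periodSet`); periods are stable under
  multiplication by `K₁` (rescale `v`) and by `K₂` (rescale `φ`) — Lemma 11.2.3 (1) — and some
  entry `P i j₀` is non-zero because `ι` is injective and `1 ⊗ b₁ j₀ ≠ 0`, so that
  `a = (a · p) · p⁻¹` lies in the period field for every `a` in the image of `K₁` or `K₂`.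

## References

* A. Huber, S. Müller-Stach, *Periods and Nori Motives*, Ergebnisse der Mathematik (3) 65,
  Springer (2017), doi:10.1007/978-3-319-50926-6; Ch. 11 "Periods of Varieties", §11.2:
  Def. 11.2.1, Rem. 11.2.2, Lemma 11.2.3. [HuberMullerStachPeriods2017]
-/

open scoped TensorProduct

noncomputable section

namespace Literature.AlgebraicGeometry.Motives

variable {K₁ : Type*} {K₂ : Type*} {L : Type*} [Field K₁] [Field K₂] [Field L]
  [Algebra K₁ L] [Algebra K₂ L]
  {V₁ : Type*} [AddCommGroup V₁] [Module K₁ V₁] {V₂ : Type*} [AddCommGroup V₂] [Module K₂ V₂]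

/-! ## Scalar stability of periods (Huber–Müller-Stach 2017, Lemma 11.2.3 (1)) -/

/-- Rescaling `v` by `c ∈ K₁` multiplies the period `φ_L(ι(1 ⊗ v))` by `c`. [folklore] -/
theorem dual_baseChange_map_one_tmul_smul (ι : L ⊗[K₁] V₁ →ₗ[L] L ⊗[K₂] V₂)
    (φ : Module.Dual K₂ V₂) (c : K₁) (v : V₁) :
    Module.Dual.baseChange L φ (ι (1 ⊗ₜ (c • v))) =
      algebraMap K₁ L c * Module.Dual.baseChange L φ (ι (1 ⊗ₜ v)) := by
  rw [TensorProduct.tmul_smul, ← algebraMap_smul L c ((1 : L) ⊗ₜ[K₁] v), map_smul, map_smul,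
    smul_eq_mul]

/-- The set of periods is stable under multiplication by `K₁` (rescale the vector;
Huber–Müller-Stach 2017, Lemma 11.2.3 (1)).
[cite: HuberMullerStachPeriods2017, Lemma 11.2.3 (1)] -/
theorem algebraMap_mul_mem_periodSet_left (ι : L ⊗[K₁] V₁ →ₗ[L] L ⊗[K₂] V₂) {x : L}
    (hx : x ∈ periodSet ι) (c : K₁) : algebraMap K₁ L c * x ∈ periodSet ι := by
  obtain ⟨v, φ, rfl⟩ := hx
  exact ⟨c • v, φ, (dual_baseChange_map_one_tmul_smul ι φ c v).symm⟩

/-- The set of periods is stable under multiplication by `K₂` (rescale the linear form;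
Huber–Müller-Stach 2017, Lemma 11.2.3 (1)).
[cite: HuberMullerStachPeriods2017, Lemma 11.2.3 (1)] -/
theorem algebraMap_mul_mem_periodSet_right (ι : L ⊗[K₁] V₁ →ₗ[L] L ⊗[K₂] V₂) {x : L}
    (hx : x ∈ periodSet ι) (d : K₂) : algebraMap K₂ L d * x ∈ periodSet ι := by
  obtain ⟨v, φ, rfl⟩ := hx
  refine ⟨v, d • φ, ?_⟩
  rw [map_smul, LinearMap.smul_apply, Algebra.smul_def]

/-! ## Expansion of periods in bases -/

variable {ι₁ ι₂ : Type*} [Fintype ι₁] [Fintype ι₂] [DecidableEq ι₁]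

omit [Fintype ι₁] [DecidableEq ι₁] in
/-- Expansion of the extended linear form in the base-changed basis `1 ⊗ b₂`:
`φ_L(y) = Σᵢ yᵢ · φ(b₂ i)`. [folklore] -/
theorem dual_baseChange_eq_sum_repr (b₂ : Module.Basis ι₂ K₂ V₂) (φ : Module.Dual K₂ V₂)
    (y : L ⊗[K₂] V₂) :
    Module.Dual.baseChange L φ y =
      ∑ i, (b₂.baseChange L).repr y i * algebraMap K₂ L (φ (b₂ i)) := by
  conv_lhs => rw [← (b₂.baseChange L).sum_repr y]
  rw [map_sum]
  refine Finset.sum_congr rfl fun i _ => ?_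
  rw [map_smul, Module.Basis.baseChange_apply, Module.Dual.baseChange_apply_tmul, smul_eq_mul,
    Algebra.smul_def, mul_one]

omit [Fintype ι₂] [DecidableEq ι₁] in
/-- Expansion of `ι(1 ⊗ v)` along the basis `b₁`: `ι(1 ⊗ v) = Σⱼ cⱼ · ι(1 ⊗ b₁ j)` for
`v = Σⱼ cⱼ b₁ j`. [folklore] -/
theorem map_one_tmul_eq_sum_repr (ι : L ⊗[K₁] V₁ →ₗ[L] L ⊗[K₂] V₂) (b₁ : Module.Basis ι₁ K₁ V₁)
    (v : V₁) : ι (1 ⊗ₜ v) = ∑ j, algebraMap K₁ L (b₁.repr v j) • ι (1 ⊗ₜ b₁ j) := by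
  conv_lhs => rw [← b₁.sum_repr v]
  rw [TensorProduct.tmul_sum, map_sum]
  refine Finset.sum_congr rfl fun j _ => ?_
  rw [TensorProduct.tmul_smul, ← algebraMap_smul L (b₁.repr v j) ((1 : L) ⊗ₜ[K₁] b₁ j), map_smul]

/-- Every period is a `K₁`-`K₂`-bilinear combination of the entries of the period matrix:
`φ_L(ι(1 ⊗ v)) = Σⱼ Σᵢ cⱼ · Pᵢⱼ · φ(b₂ i)` where `v = Σⱼ cⱼ b₁ j` and `P = periodMatrix ι b₁ b₂`
(Huber–Müller-Stach 2017, Rem. 11.2.2 (1): the periods, i.e. the image of the pairing, versus the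
entries of the period matrix of Def. 11.2.1). [cite: HuberMullerStachPeriods2017, Rem. 11.2.2 (1)] -/
theorem dual_baseChange_map_one_tmul_eq_sum (ι : L ⊗[K₁] V₁ →ₗ[L] L ⊗[K₂] V₂)
    (b₁ : Module.Basis ι₁ K₁ V₁) (b₂ : Module.Basis ι₂ K₂ V₂) (v : V₁) (φ : Module.Dual K₂ V₂) :
    Module.Dual.baseChange L φ (ι (1 ⊗ₜ v)) =
      ∑ j, ∑ i, algebraMap K₁ L (b₁.repr v j) * periodMatrix ι b₁ b₂ i j *
        algebraMap K₂ L (φ (b₂ i)) := by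
  rw [map_one_tmul_eq_sum_repr ι b₁ v, map_sum]
  refine Finset.sum_congr rfl fun j _ => ?_
  rw [map_smul, smul_eq_mul, dual_baseChange_eq_sum_repr b₂, Finset.mul_sum]
  refine Finset.sum_congr rfl fun i _ => ?_
  rw [periodMatrix_apply, mul_assoc]

/-- For `ι` injective and `j₀ : ι₁`, some entry of the `j₀`-th column of the period matrix is
non-zero (`1 ⊗ b₁ j₀ ≠ 0`, so `ι(1 ⊗ b₁ j₀) ≠ 0` has a non-zero coordinate). [folklore] -/
theorem exists_periodMatrix_ne_zero (ι : L ⊗[K₁] V₁ →ₗ[L] L ⊗[K₂] V₂) (hι : Function.Injective ι)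
    (b₁ : Module.Basis ι₁ K₁ V₁) (b₂ : Module.Basis ι₂ K₂ V₂) (j₀ : ι₁) :
    ∃ i, periodMatrix ι b₁ b₂ i j₀ ≠ 0 := by
  by_contra! h
  refine (b₁.baseChange L).ne_zero j₀ (hι ?_)
  rw [map_zero, ← (b₂.baseChange L).repr.map_eq_zero_iff]
  ext i
  rw [Module.Basis.baseChange_apply, ← periodMatrix_apply, h i, Finsupp.zero_apply]

/-! ## The discharge -/

/-- **Discharge of `periodField_eq_closure_range_periodMatrix`** (Huber–Müller-Stach 2017, §11.2):
for an injective `L`-linear `ι : L ⊗_{K₁} V₁ → L ⊗_{K₂} V₂`, `V₁ ≠ 0` (`ι₁` non-empty) and finite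
bases `b₁` of `V₁`, `b₂` of `V₂`, the subfield of `L` generated by the periods `φ_L(ι(1 ⊗ v))`
equals the subfield generated by the images of `K₁`, `K₂` and the entries of the period matrix of
`ι` in the bases `b₁`, `b₂`. `⊆`: every period is a `K₁`-`K₂`-bilinear combination of the
entries (`dual_baseChange_map_one_tmul_eq_sum`; Rem. 11.2.2 (1) with Def. 11.2.1). `⊇`: the
entries are periods; periods are stable under `K₁` and `K₂` (Lemma 11.2.3 (1)) and a non-zero
period `p` (a non-zero entry, `exists_periodMatrix_ne_zero`) gives `a = (a p) p⁻¹` for `a` in the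
image of `K₁` or `K₂`.
[cite: HuberMullerStachPeriods2017, §11.2 (Def. 11.2.1, Rem. 11.2.2 (1), Lemma 11.2.3 (1))] -/
theorem periodField_eq_closure_range_periodMatrix_holds :
    periodField_eq_closure_range_periodMatrix (K₁ := K₁) (K₂ := K₂) (L := L) (V₁ := V₁)
      (V₂ := V₂) (ι₁ := ι₁) (ι₂ := ι₂) := by
  intro _ ι hι b₁ b₂
  apply le_antisymm
  · refine Subfield.closure_le.mpr ?_
    rintro x ⟨v, φ, rfl⟩
    rw [dual_baseChange_map_one_tmul_eq_sum ι b₁ b₂ v φ]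
    refine sum_mem fun j _ => sum_mem fun i _ => mul_mem (mul_mem ?_ ?_) ?_
    · exact Subfield.subset_closure (Or.inl (Or.inl ⟨_, rfl⟩))
    · exact Subfield.subset_closure (Or.inr ⟨(i, j), rfl⟩)
    · exact Subfield.subset_closure (Or.inl (Or.inr ⟨_, rfl⟩))
  · obtain ⟨j₀⟩ := ‹Nonempty ι₁›
    obtain ⟨i₀, hi₀⟩ := exists_periodMatrix_ne_zero ι hι b₁ b₂ j₀
    have hp : periodMatrix ι b₁ b₂ i₀ j₀ ∈ periodSet ι := periodMatrix_mem_periodSet ι b₁ b₂ i₀ j₀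
    have hp' : periodMatrix ι b₁ b₂ i₀ j₀ ∈ periodField ι := periodSet_subset_periodField ι hp
    refine Subfield.closure_le.mpr ?_
    rintro x ((⟨c, rfl⟩ | ⟨d, rfl⟩) | ⟨p, rfl⟩)
    · rw [← mul_inv_cancel_right₀ hi₀ (algebraMap K₁ L c)]
      exact mul_mem (periodSet_subset_periodField ι (algebraMap_mul_mem_periodSet_left ι hp c))
        (inv_mem hp')
    · rw [← mul_inv_cancel_right₀ hi₀ (algebraMap K₂ L d)]
      exact mul_mem (periodSet_subset_periodField ι (algebraMap_mul_mem_periodSet_right ι hp d))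
        (inv_mem hp')
    · exact periodSet_subset_periodField ι (periodMatrix_mem_periodSet ι b₁ b₂ p.1 p.2)

end Literature.AlgebraicGeometry.Motives

end
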